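import Literature.AnabelianGeometry.SemiGraphs.QuasiTemperoidsQDPairs
import Literature.AlgebraicGeometry.Frobenioids.QuasiTemperoidOrbits
import HarnessLib

/-!
# Semi-graphs of anabelioids, Appendix: Remark A.3.1 — the model `B^temp(Π, Π°)` (proofs, part 1)

Mochizuki, *Semi-graphs of anabelioids*, Publ. RIMS **42** (2006) 221–322, Appendix
"Quasi-temperoids", Remark A.3.1, manuscript p. 82 [cite: MochizukiSemiAnbd2006, Rmk A.3.1 p.82]:
for a morphism of QD-pairs of a connected quasi-temperoid, "(a) 0-proper ⟺ (b) epimorphism ⟺ (c)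
`B` is the colimit of the two projections `A ×_B A → A`".  Proof-only file (no definitions), part 1:
the statements are established in the MODEL `B^temp(Π, Π°)` (`BTempRel Π Π°`, [FrdII] Ex. 1.3 (i) =
[SemiAnbd] Def. A.1 (i)), where everything is a statement about countable `Π`-sets over `Π/Π°`:

* `epi_iff_surjective` — a morphism of `B^temp(Π, Π°)` is an epimorphism iff it is surjective on
  points (test object: the disjoint union `Y ⊔ Y`, which — unlike the two-point trivial `Π`-set used
  for `B^temp(Π)` — lies in `B^temp(Π, Π°)`);
* `injective_of_isColimit_binaryCofan` — a coprojection is injective on points (compare with the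
  honest disjoint union); `exists_isComponent_orbit` — every orbit, with its inclusion, is a connected
  component in the sense of Def. A.3 (`IsComponent`);
* `isZeroProper_iff_surjective` — Rmk A.3.1 (a) ⟺ (b) in the model: a morphism of QD-pairs is
  0-proper iff its arrow is surjective on points.

Part 2 (`QuasiTemperoidsRmkA31Proofs.lean`) adds (c) and transports along the chart
`Q ≌ B^temp(Π, Π°)`.  Nothing here bears on [IUTchIII] Cor. 3.12.
-/

open CategoryTheory CategoryTheory.Limits Topology

namespace Literature.AnabelianGeometry.SemiGraphs

namespace RmkA31Model

open Literature.AlgebraicGeometry.Frobenioids (IsConnectedObj IsNonemptyObj)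
open Literature.AlgebraicGeometry.Frobenioids.QuasiTemperoid (BTempRel cosetAction)
open Literature.AlgebraicGeometry.Frobenioids.QuasiTemperoid.BTempRel (hom_ρ hom_ext_apply
  ρ_one_apply ρ_mul_apply ρ_inv_apply isNonemptyObj_of_nonempty nonempty_of_isNonemptyObj
  exists_ρ_eq_of_isConnectedObj isConnectedObj_of_transitive nonempty_of_isConnectedObj
  hom_eq_of_apply_eq exists_hom_of_stabilizer_le)

universe u

variable {G : Type u} [Group G] [TopologicalSpace G] {H : Subgroup G}

/-! ### Epimorphisms of `B^temp(Π, Π°)` are the surjections -/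

/-- A morphism of `B^temp(Π, Π°)` that is surjective on points is an epimorphism (morphisms are
determined by their underlying functions). [cite: MochizukiSemiAnbd2006, Rmk A.3.1 p.82] -/
theorem epi_of_surjective {X Y : BTempRel G H} (f : X ⟶ Y)
    (hf : Function.Surjective fun x : X.obj.obj.V => (f.hom.hom.hom x : Y.obj.obj.V)) : Epi f := by
  constructor
  intro Z g h e
  apply hom_ext_apply
  intro y
  obtain ⟨x, rfl⟩ := hf y
  exact congrArg (fun φ : X ⟶ Z => (φ.hom.hom.hom x : Z.obj.obj.V)) e

/-- The disjoint union `Y ⊔ Z` of two objects of `B^temp(Π, Π°)`, as an object of `B^temp(Π, Π°)`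
with its two (injective, jointly surjective) inclusions and case-defined maps out of it: an
elimination principle packaging the construction (countable, stabilisers those of the summands,
structure map to `Π/Π°` by cases). [cite: MochizukiSemiAnbd2006, Rmk A.3.1 p.82] -/
theorem exists_sum (Y Z : BTempRel G H) :
    ∃ (W : BTempRel G H) (e : W.obj.obj.V ≃ Y.obj.obj.V ⊕ Z.obj.obj.V) (j₁ : Y ⟶ W) (j₂ : Z ⟶ W),
      (∀ y, e (j₁.hom.hom.hom y) = Sum.inl y) ∧ (∀ z, e (j₂.hom.hom.hom z) = Sum.inr z) ∧
      (∀ (g : G) (y : Y.obj.obj.V), W.obj.obj.ρ g (e.symm (Sum.inl y)) =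
        e.symm (Sum.inl (Y.obj.obj.ρ g y))) ∧
      (∀ (g : G) (z : Z.obj.obj.V), W.obj.obj.ρ g (e.symm (Sum.inr z)) =
        e.symm (Sum.inr (Z.obj.obj.ρ g z))) ∧
      ∀ (T : BTempRel G H) (φ : Y.obj.obj.V ⊕ Z.obj.obj.V → T.obj.obj.V),
        (∀ (g : G) (y : Y.obj.obj.V), φ (Sum.inl (Y.obj.obj.ρ g y)) = T.obj.obj.ρ g (φ (Sum.inl y))) →
        (∀ (g : G) (z : Z.obj.obj.V), φ (Sum.inr (Z.obj.obj.ρ g z)) = T.obj.obj.ρ g (φ (Sum.inr z))) →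
        ∃ d : W ⟶ T, ∀ w, (d.hom.hom.hom w : T.obj.obj.V) = φ (e w) := by
  letI : MulAction G Y.obj.obj.V := Action.instMulAction Y.obj.obj
  letI : MulAction G Z.obj.obj.V := Action.instMulAction Z.obj.obj
  obtain ⟨tY⟩ := Y.property
  obtain ⟨tZ⟩ := Z.property
  let WA : Action (Type u) G := Action.ofMulAction G (Y.obj.obj.V ⊕ Z.obj.obj.V)
  let W : BTempRel G H :=
    ⟨⟨WA, by
      haveI : Countable Y.obj.obj.V := Y.obj.property.1
      haveI : Countable Z.obj.obj.V := Z.obj.property.1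
      refine ⟨inferInstanceAs (Countable (Y.obj.obj.V ⊕ Z.obj.obj.V)), fun w => ?_⟩
      rcases w with y | z
      · have : {g : G | WA.ρ g (Sum.inl y) = Sum.inl y} = {g : G | Y.obj.obj.ρ g y = y} := by
          ext g
          simp only [Set.mem_setOf_eq]
          change g • (Sum.inl y : Y.obj.obj.V ⊕ Z.obj.obj.V) = Sum.inl y ↔ g • y = y
          rw [Sum.smul_inl, Sum.inl.injEq]
        rw [this]
        exact Y.obj.property.2 y
      · have : {g : G | WA.ρ g (Sum.inr z) = Sum.inr z} = {g : G | Z.obj.obj.ρ g z = z} := by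
          ext g
          simp only [Set.mem_setOf_eq]
          change g • (Sum.inr z : Y.obj.obj.V ⊕ Z.obj.obj.V) = Sum.inr z ↔ g • z = z
          rw [Sum.smul_inr, Sum.inr.injEq]
        rw [this]
        exact Z.obj.property.2 z⟩,
      ⟨{ hom := TypeCat.ofHom (Sum.elim (fun y => tY.hom y) (fun z => tZ.hom z)),
         comm := fun g => by
            apply ConcreteCategory.hom_ext
            intro w
            rcases w with y | z
            · change Sum.elim (fun y => tY.hom y) (fun z => tZ.hom z)
                  (g • (Sum.inl y : Y.obj.obj.V ⊕ Z.obj.obj.V)) = (cosetAction G H).ρ g (tY.hom y)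
              rw [Sum.smul_inl, Sum.elim_inl]
              exact ConcreteCategory.congr_hom (tY.comm g) y
            · change Sum.elim (fun y => tY.hom y) (fun z => tZ.hom z)
                  (g • (Sum.inr z : Y.obj.obj.V ⊕ Z.obj.obj.V)) = (cosetAction G H).ρ g (tZ.hom z)
              rw [Sum.smul_inr, Sum.elim_inr]
              exact ConcreteCategory.congr_hom (tZ.comm g) z }⟩⟩
  let j₁ : Y ⟶ W := ObjectProperty.homMk (ObjectProperty.homMk
    { hom := TypeCat.ofHom fun y => (Sum.inl y : Y.obj.obj.V ⊕ Z.obj.obj.V)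
      comm := fun g => by
        apply ConcreteCategory.hom_ext
        intro y
        change (Sum.inl (Y.obj.obj.ρ g y) : Y.obj.obj.V ⊕ Z.obj.obj.V) =
          g • (Sum.inl y : Y.obj.obj.V ⊕ Z.obj.obj.V)
        rw [Sum.smul_inl]
        rfl })
  let j₂ : Z ⟶ W := ObjectProperty.homMk (ObjectProperty.homMk
    { hom := TypeCat.ofHom fun z => (Sum.inr z : Y.obj.obj.V ⊕ Z.obj.obj.V)
      comm := fun g => by
        apply ConcreteCategory.hom_ext
        intro z
        change (Sum.inr (Z.obj.obj.ρ g z) : Y.obj.obj.V ⊕ Z.obj.obj.V) =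
          g • (Sum.inr z : Y.obj.obj.V ⊕ Z.obj.obj.V)
        rw [Sum.smul_inr]
        rfl })
  refine ⟨W, Equiv.refl _, j₁, j₂, fun _ => rfl, fun _ => rfl, fun g y => ?_, fun g z => ?_,
    fun T φ h₁ h₂ => ?_⟩
  · change g • (Sum.inl y : Y.obj.obj.V ⊕ Z.obj.obj.V) = Sum.inl (g • y)
    rw [Sum.smul_inl]
  · change g • (Sum.inr z : Y.obj.obj.V ⊕ Z.obj.obj.V) = Sum.inr (g • z)
    rw [Sum.smul_inr]
  · refine ⟨ObjectProperty.homMk (ObjectProperty.homMk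
      { hom := TypeCat.ofHom φ
        comm := fun g => ?_ }), fun _ => rfl⟩
    apply ConcreteCategory.hom_ext
    intro w
    rcases w with y | z
    · change φ (g • (Sum.inl y : Y.obj.obj.V ⊕ Z.obj.obj.V)) = T.obj.obj.ρ g (φ (Sum.inl y))
      rw [Sum.smul_inl]
      exact h₁ g y
    · change φ (g • (Sum.inr z : Y.obj.obj.V ⊕ Z.obj.obj.V)) = T.obj.obj.ρ g (φ (Sum.inr z))
      rw [Sum.smul_inr]
      exact h₂ g z

/-- **`B^temp(Π, Π°)`: epimorphisms are surjective on points.** If `y` is missed by `f : X → Y`, the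
two maps `Y → Y ⊔ Y` — the left inclusion, and "left on the image of `f`, right off it" (the image is
`Π`-stable) — agree after `f` but differ at `y`. [cite: MochizukiSemiAnbd2006, Rmk A.3.1 p.82] -/
theorem surjective_of_epi {X Y : BTempRel G H} (f : X ⟶ Y) [Epi f] :
    Function.Surjective fun x : X.obj.obj.V => (f.hom.hom.hom x : Y.obj.obj.V) := by
  classical
  intro y
  by_contra hy
  obtain ⟨W, e, j₁, j₂, hj₁, hj₂, -, -, -⟩ := exists_sum Y Y
  have hstable : ∀ (g : G) (z : Y.obj.obj.V),
      (∃ x, (f.hom.hom.hom x : Y.obj.obj.V) = Y.obj.obj.ρ g z) ↔ ∃ x, (f.hom.hom.hom x : _) = z := by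
    intro g z
    constructor
    · rintro ⟨x, hx⟩
      refine ⟨X.obj.obj.ρ g⁻¹ x, ?_⟩
      rw [hom_ρ, hx, ρ_inv_apply]
    · rintro ⟨x, hx⟩
      refine ⟨X.obj.obj.ρ g x, ?_⟩
      rw [hom_ρ, hx]
  -- the map "left on the image, right off the image"
  let vfun : Y.obj.obj.V → W.obj.obj.V := fun z =>
    if ∃ x, (f.hom.hom.hom x : Y.obj.obj.V) = z then j₁.hom.hom.hom z else j₂.hom.hom.hom z
  have vfun_pos : ∀ z, (∃ x, (f.hom.hom.hom x : Y.obj.obj.V) = z) → vfun z = j₁.hom.hom.hom z :=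
    fun z h => if_pos h
  have vfun_neg : ∀ z, ¬ (∃ x, (f.hom.hom.hom x : Y.obj.obj.V) = z) → vfun z = j₂.hom.hom.hom z :=
    fun z h => if_neg h
  let v : Y ⟶ W := ObjectProperty.homMk (ObjectProperty.homMk
    { hom := TypeCat.ofHom vfun
      comm := fun g => by
        apply ConcreteCategory.hom_ext
        intro z
        change vfun (Y.obj.obj.ρ g z) = W.obj.obj.ρ g (vfun z)
        by_cases h : ∃ x, (f.hom.hom.hom x : Y.obj.obj.V) = z
        · rw [vfun_pos z h, vfun_pos _ ((hstable g z).mpr h), hom_ρ]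
        · rw [vfun_neg z h, vfun_neg _ (fun h' => h ((hstable g z).mp h')), hom_ρ] })
  have huv : f ≫ j₁ = f ≫ v := by
    apply hom_ext_apply
    intro x
    change (j₁.hom.hom.hom (f.hom.hom.hom x) : W.obj.obj.V) = vfun (f.hom.hom.hom x)
    rw [vfun_pos _ ⟨x, rfl⟩]
  have hjv : j₁ = v := (cancel_epi f).mp huv
  have h1 : (j₁.hom.hom.hom y : W.obj.obj.V) = vfun y := congrArg (fun φ : Y ⟶ W => φ.hom.hom.hom y) hjv
  rw [vfun_neg y hy] at h1
  have h2 := congrArg e h1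
  rw [hj₁, hj₂] at h2
  exact Sum.inl_ne_inr h2

/-- **`B^temp(Π, Π°)`: a morphism is an epimorphism iff it is surjective on points.**
[cite: MochizukiSemiAnbd2006, Rmk A.3.1 p.82] -/
theorem epi_iff_surjective {X Y : BTempRel G H} (f : X ⟶ Y) :
    Epi f ↔ Function.Surjective fun x : X.obj.obj.V => (f.hom.hom.hom x : Y.obj.obj.V) :=
  ⟨fun _ => surjective_of_epi f, epi_of_surjective f⟩

/-! ### Coprojections and components -/

/-- A coprojection of `B^temp(Π, Π°)` (a leg of a colimit binary cofan) is injective on points: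
compare with the honest disjoint union. [cite: MochizukiSemiAnbd2006, Def A.3(i) p.82] -/
theorem injective_of_isColimit_binaryCofan {D D' T : BTempRel G H} (κ : D ⟶ T) (κ' : D' ⟶ T)
    (hc : IsColimit (BinaryCofan.mk κ κ')) :
    Function.Injective fun d : D.obj.obj.V => (κ.hom.hom.hom d : T.obj.obj.V) := by
  obtain ⟨W, e, j₁, j₂, hj₁, -, -, -, -⟩ := exists_sum D D'
  let desc : T ⟶ W := hc.desc (BinaryCofan.mk j₁ j₂)
  have hdesc : κ ≫ desc = j₁ := hc.fac (BinaryCofan.mk j₁ j₂) ⟨WalkingPair.left⟩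
  have key : ∀ d : D.obj.obj.V, e (desc.hom.hom.hom (κ.hom.hom.hom d)) = Sum.inl d := by
    intro d
    change e ((κ ≫ desc).hom.hom.hom d) = _
    rw [hdesc]
    exact hj₁ d
  intro d₁ d₂ h
  have h1 := key d₁
  have h2 := key d₂
  change (κ.hom.hom.hom d₁ : T.obj.obj.V) = κ.hom.hom.hom d₂ at h
  rw [h, h2] at h1
  exact (Sum.inl_injective h1).symm

/-- The source of a coprojection `κ : D ⟶ T` with `D` connected is a single orbit: every point of
`D` is a translate of any given one. [cite: MochizukiSemiAnbd2006, Def A.3(i) p.82] -/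
theorem exists_ρ_eq_of_isComponent {D T : BTempRel G H} {κ : D ⟶ T} (hκ : IsComponent κ)
    (d₀ d : D.obj.obj.V) : ∃ g : G, D.obj.obj.ρ g d₀ = d :=
  exists_ρ_eq_of_isConnectedObj D hκ.1 d₀ d

/-- **Orbits are components**: for a point `x₀` of an object `T` of `B^temp(Π, Π°)`, the orbit of
`x₀` (a sub-`Π`-set over `Π/Π°`) with its inclusion is a connected component of `T` in the sense of
Def. A.3 — connected (one orbit) and a coprojection (`T = Π·x₀ ⊔ (T ∖ Π·x₀)` in `B^temp(Π, Π°)`) —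
and the inclusion is injective and hits `x₀`. [cite: MochizukiSemiAnbd2006, Def A.3(i) p.82] -/
theorem exists_isComponent_orbit (T : BTempRel G H) (x₀ : T.obj.obj.V) :
    ∃ (C : BTempRel G H) (ι : C ⟶ T) (c₀ : C.obj.obj.V), IsComponent ι ∧
      (ι.hom.hom.hom c₀ : T.obj.obj.V) = x₀ ∧
      Function.Injective fun c : C.obj.obj.V => (ι.hom.hom.hom c : T.obj.obj.V) := by
  classical
  letI : MulAction G T.obj.obj.V := Action.instMulAction T.obj.obj
  obtain ⟨t⟩ := T.property
  -- sub-`Π`-sets as objects of `B^temp(Π, Π°)`, with their inclusions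
  let BA : SubMulAction G T.obj.obj.V → Action (Type u) G := fun S =>
    { V := S, ρ := (Action.ofMulAction G S).ρ }
  let ιA : ∀ S : SubMulAction G T.obj.obj.V, BA S ⟶ T.obj.obj := fun S =>
    { hom := TypeCat.ofHom fun y : S => (y.1 : T.obj.obj.V)
      comm := fun _ => by
        apply ConcreteCategory.hom_ext
        intro y
        rfl }
  let B : SubMulAction G T.obj.obj.V → BTempRel G H := fun S =>
    ⟨⟨BA S, by
      haveI : Countable T.obj.obj.V := T.obj.property.1
      refine ⟨inferInstanceAs (Countable S), fun (y : S) => ?_⟩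
      change IsOpen {g : G | (Action.ofMulAction G S).ρ g y = y}
      have : {g : G | (Action.ofMulAction G S).ρ g y = y} =
          {g : G | T.obj.obj.ρ g y.1 = y.1} := by
        ext g
        simp only [Set.mem_setOf_eq]
        change g • y = y ↔ g • (y.1 : T.obj.obj.V) = y.1
        rw [Subtype.ext_iff, SubMulAction.val_smul]
      rw [this]
      exact T.obj.property.2 y.1⟩, ⟨ιA S ≫ t⟩⟩
  let ι : ∀ S : SubMulAction G T.obj.obj.V, B S ⟶ T := fun S =>
    ObjectProperty.homMk (ObjectProperty.homMk (ιA S))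
  -- the orbit of `x₀` and its complement
  let S : SubMulAction G T.obj.obj.V :=
    { carrier := MulAction.orbit G x₀
      smul_mem' := fun g {_} hy => MulAction.mem_orbit_of_mem_orbit g hy }
  let Sc : SubMulAction G T.obj.obj.V :=
    { carrier := (S : Set T.obj.obj.V)ᶜ
      smul_mem' := fun g {y} hy => by
        intro hgy
        apply hy
        have := S.smul_mem g⁻¹ hgy
        rwa [inv_smul_smul] at this }
  -- `T = S ⊔ Sc` in `B^temp(Π, Π°)`
  let d : ∀ s : BinaryCofan (B S) (B Sc), T.obj.obj.V → s.pt.obj.obj.V := fun s y =>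
    if hy : y ∈ S then s.inl.hom.hom.hom (⟨y, hy⟩ : S) else s.inr.hom.hom.hom (⟨y, hy⟩ : Sc)
  have hd₁ : ∀ s y (hy : y ∈ S), d s y = s.inl.hom.hom.hom (⟨y, hy⟩ : S) := fun s y hy => by
    simp only [d, dif_pos hy]
  have hd₂ : ∀ s y (hy : y ∉ S), d s y = s.inr.hom.hom.hom (⟨y, hy⟩ : Sc) := fun s y hy => by
    simp only [d, dif_neg hy]
  have hcol : Nonempty (IsColimit (BinaryCofan.mk (ι S) (ι Sc))) := by
    refine ⟨BinaryCofan.isColimitMk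
      (fun s => ObjectProperty.homMk (ObjectProperty.homMk
        { hom := TypeCat.ofHom (d s)
          comm := fun g => ?_ })) ?_ ?_ ?_⟩
    · apply ConcreteCategory.hom_ext
      intro y
      change d s (g • y) = s.pt.obj.obj.ρ g (d s y)
      by_cases hy : y ∈ S
      · rw [hd₁ s y hy, hd₁ s (g • y) (S.smul_mem g hy)]
        exact ConcreteCategory.congr_hom (s.inl.hom.hom.comm g) (⟨y, hy⟩ : S)
      · rw [hd₂ s y hy, hd₂ s (g • y) (Sc.smul_mem g hy)]
        exact ConcreteCategory.congr_hom (s.inr.hom.hom.comm g) (⟨y, hy⟩ : Sc)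
    · intro s
      apply hom_ext_apply
      intro y
      change d s (y.1 : T.obj.obj.V) = s.inl.hom.hom.hom y
      rw [hd₁ s y.1 y.2]
    · intro s
      apply hom_ext_apply
      intro y
      change d s (y.1 : T.obj.obj.V) = s.inr.hom.hom.hom y
      rw [hd₂ s y.1 y.2]
    · intro s m h₁ h₂
      apply hom_ext_apply
      intro y
      change m.hom.hom.hom y = d s y
      by_cases hy : y ∈ S
      · rw [hd₁ s y hy, ← h₁]
        rfl
      · rw [hd₂ s y hy, ← h₂]
        rfl
  -- the orbit is connected (a single orbit of `B S`)
  have hconn : IsConnectedObj (B S) := by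
    refine isConnectedObj_of_transitive (B S) (⟨x₀, MulAction.mem_orbit_self x₀⟩ : S) ?_
    rintro ⟨y, ⟨g, hg⟩⟩
    refine ⟨g, Subtype.ext ?_⟩
    change g • x₀ = y
    exact hg
  refine ⟨B S, ι S, ⟨x₀, MulAction.mem_orbit_self x₀⟩, ⟨hconn, B Sc, ι Sc, hcol⟩, rfl, ?_⟩
  intro c₁ c₂ h
  exact Subtype.ext h

/-! ### Remark A.3.1 (a) ⟺ (b) in the model -/

/-- **Remark A.3.1, (a) ⟺ (b), in the model `B^temp(Π, Π°)`**: a morphism of QD-pairs is 0-proper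
(every connected component of the target receives an arrow, over the map, from a connected component
of the source) iff its arrow is surjective on points [iff it is an epimorphism, `epi_iff_surjective`].
(⇒): the orbit of `y` is a component, any component mapping to it has a point, and the image is
`Π`-stable. (⇐): lift a point of the given component `D` to `x₀`; the orbit of `x₀` maps to `D`
because the stabiliser of `x₀` fixes the lift (coprojections are injective), and the square
commutes since both composites agree at `x₀` on a single orbit.
[cite: MochizukiSemiAnbd2006, Rmk A.3.1 p.82] -/
theorem isZeroProper_iff_surjective {P₁ P₂ : QDPair (BTempRel G H)} (f : QDPair.Hom P₁ P₂) :
    f.IsZeroProper ↔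
      Function.Surjective fun x : P₁.A.obj.obj.V => (f.hom.hom.hom.hom x : P₂.A.obj.obj.V) := by
  constructor
  · intro h0 y
    obtain ⟨C, κ, c₀, hκ, hc₀, -⟩ := exists_isComponent_orbit P₂.A y
    obtain ⟨C', ι, k, hι, hcomm⟩ := h0 κ hκ
    obtain ⟨c'⟩ := nonempty_of_isConnectedObj C' hι.1
    obtain ⟨g, hg⟩ := exists_ρ_eq_of_isComponent hκ c₀ (k.hom.hom.hom c')
    refine ⟨P₁.A.obj.obj.ρ g⁻¹ (ι.hom.hom.hom c'), ?_⟩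
    change (f.hom.hom.hom.hom (P₁.A.obj.obj.ρ g⁻¹ (ι.hom.hom.hom c')) : P₂.A.obj.obj.V) = y
    have e1 : (f.hom.hom.hom.hom (ι.hom.hom.hom c') : P₂.A.obj.obj.V) =
        κ.hom.hom.hom (k.hom.hom.hom c') :=
      congrArg (fun φ : C' ⟶ P₂.A => (φ.hom.hom.hom c' : P₂.A.obj.obj.V)) hcomm
    rw [hom_ρ, e1, ← hg, hom_ρ, ρ_inv_apply, hc₀]
  · intro hsurj D κ hκ
    obtain ⟨d₀⟩ := nonempty_of_isConnectedObj D hκ.1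
    obtain ⟨x₀, hx₀⟩ := hsurj (κ.hom.hom.hom d₀)
    change (f.hom.hom.hom.hom x₀ : P₂.A.obj.obj.V) = κ.hom.hom.hom d₀ at hx₀
    obtain ⟨C, ι, c₀, hι, hc₀, hinj⟩ := exists_isComponent_orbit P₁.A x₀
    obtain ⟨D', κ', ⟨hc⟩⟩ := hκ.2
    have hκinj := injective_of_isColimit_binaryCofan κ κ' hc
    -- the map `C → D`, `c₀ ↦ d₀`
    obtain ⟨k, hk⟩ := exists_hom_of_stabilizer_le (T₁ := C) (T₂ := D) c₀
      (exists_ρ_eq_of_isComponent hι c₀) d₀ (fun g hg => by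
        apply hκinj
        change (κ.hom.hom.hom (D.obj.obj.ρ g d₀) : P₂.A.obj.obj.V) = κ.hom.hom.hom d₀
        rw [hom_ρ, ← hx₀, ← hom_ρ, ← hc₀, ← hom_ρ, hg])
    refine ⟨C, ι, k, hι, ?_⟩
    apply hom_eq_of_apply_eq hι.1 _ _ c₀
    change (f.hom.hom.hom.hom (ι.hom.hom.hom c₀) : P₂.A.obj.obj.V) = κ.hom.hom.hom (k.hom.hom.hom c₀)
    rw [hc₀, hx₀, hk]

end RmkA31Model

end Literature.AnabelianGeometry.SemiGraphs
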